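import Mathlib
import Literature.Geometry.DiscreteGeometry.TwoShellChartCertFcc
import Literature.Geometry.DiscreteGeometry.TwoShellChartCertHcp
import Summits.AtomisticToContinuum.Crystallization.Theorems.NashClassCertificatesNashNearFieldStubLabelledPlacementTree
import Summits.AtomisticToContinuum.Crystallization.Theorems.NashClassCertificatesNashNearFieldStubLabelledPlacementLeaf

/-!
# Crux `NashClassCertificates.NashNearField` (stmt-AtomisticToContinuum-16827), line `birth`:
# stub `stub_labelledPlacement` — the FINAL ASSEMBLY

The registered stub (verbatim the hypothesis of the landed `stub_chartCore_of_labelled_placement`): at a particle whose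
`3`-ball is `1/20`-good, with goodness witness `(a, A, P, f)`, a frame `R`, a Hägg word `s` with the bridge clauses and, for
every pattern neighbour, a goodness witness with an injective ADJACENT site labelling of its pattern, metrically accurate to
`2/5`.  Proof: normalise to the centre's frame (`pos k = A⁻¹ (x k − x i)/a`), read the goodness witnesses as `CentreGood` /
`PivotGood` data of the `√18` model, take the actual labels of every pivot to a representative of the certificate
(`exists_rep_witness`, composing the witness with a pattern symmetry), run the kernel-checked decision tree
(`checkAllOrbits_fcc/hcp`, `checkTree_fcc/hcp` of `TwoShellChartCert*`, soundness `checkTree_sound`), and read the leaf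
(`bridge_i`, `bridge_ii`, `leafGoal_placement`) back in the original coordinates with `R = ctxFrame κ`, `s = ctxWord κ`.
-/

noncomputable section

open Literature.Geometry.DiscreteGeometry Literature.Geometry.DiscreteGeometry.TwoShellCheck
  Literature.Geometry.DiscreteGeometry.TwoShellChart Literature.MathematicalPhysics.StatisticalMechanics

namespace Summit.AtomisticToContinuum.Crystallization.Theorems.NashClassCertificatesNashNearField

/-! ### Orbit data of all pivots -/

/-- From `checkAllOrbits`: every pivot has certified commons, representatives and orbit assignment. -/
theorem orbits_of_checkAllOrbits {cen : List IVec} {data : List PivotReps} {assigns : List (IVec × List (ℕ × ℕ))}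
    (h : checkAllOrbits cen data assigns = true) :
    ∀ v ∈ cen, ∃ cs reps assign, repsOf data v = some (cs, reps) ∧ checkOrbits cen v cs reps assign = true := by
  unfold checkAllOrbits at h
  simp only [Bool.and_eq_true, beq_iff_eq] at h
  obtain ⟨hlen, hall⟩ := h
  intro v hv
  obtain ⟨k, hk, rfl⟩ := List.mem_iff_getElem.1 hv
  have hk' : k < assigns.length := by omega
  have hz := all_zip_getElem hall k hk hk'
  simp only [Bool.and_eq_true] at hz
  obtain ⟨hveq, hm⟩ := hz
  cases hro : repsOf data (cen[k]) with
  | none => rw [hro] at hm; exact absurd hm (by simp)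
  | some csr =>
    obtain ⟨cs, reps⟩ := csr
    rw [hro] at hm
    exact ⟨cs, reps, (assigns[k]).2, rfl, hm⟩

/-! ### The main statement, for a fixed centre type and certificate -/

/-- **The labelled placement, given an accepted certificate for the centre's pattern type.** -/
theorem labelledPlacement_of_cert (cenHcp : Bool) (data : List PivotReps) (assigns : List (IVec × List (ℕ × ℕ)))
    (cert : Cert) (horb : checkAllOrbits (modelList cenHcp) data assigns = true)
    (htree : checkTree (modelList cenHcp) data 40 [] cert = true)
    (N : ℕ) (x : Fin N → EuclideanSpace ℝ (Fin 3)) (i : Fin N)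
    (hgood : ∀ k : Fin N, dist (x k) (x i) ≤ 3 → IsTwoShellGood (1 / 20) (47 / 50) 1 x k)
    (a : ℝ) (A : EuclideanSpace ℝ (Fin 3) →ₗᵢ[ℝ] EuclideanSpace ℝ (Fin 3)) (f : EuclideanSpace ℝ (Fin 3) → Fin N)
    (ha1 : 47 / 50 ≤ a) (ha2 : a ≤ 1)
    (hf : ∀ v ∈ patternOf cenHcp, f v ≠ i ∧ dist (x (f v)) (x i + a • A v) ≤ 1 / 20 * a)
    (hinj : Set.InjOn f ↑(patternOf cenHcp))
    (hcomp : ∀ j : Fin N, j ≠ i → dist (x j) (x i) ≤ 3 / 2 * a → ∃ v ∈ patternOf cenHcp, f v = j) :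
    ∃ (R : EuclideanSpace ℝ (Fin 3) →ₗᵢ[ℝ] EuclideanSpace ℝ (Fin 3)) (s : ℤ → ℤ), IsHaggSeq s ∧
      (∀ v ∈ patternOf cenHcp, ∃ m u w : ℤ, R (barlowPos 1 (Real.sqrt 6 / 3) s m u w) = v) ∧
      (∀ m u w : ℤ, ‖barlowPos 1 (Real.sqrt 6 / 3) s m u w‖ ≤ 3 / 2 → barlowPos 1 (Real.sqrt 6 / 3) s m u w ≠ 0 →
        R (barlowPos 1 (Real.sqrt 6 / 3) s m u w) ∈ patternOf cenHcp) ∧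
      (∀ v ∈ patternOf cenHcp, ∃ (a' : ℝ) (A' : EuclideanSpace ℝ (Fin 3) →ₗᵢ[ℝ] EuclideanSpace ℝ (Fin 3))
        (P' : Finset (EuclideanSpace ℝ (Fin 3))) (f' : EuclideanSpace ℝ (Fin 3) → Fin N)
        (σm σu σw : EuclideanSpace ℝ (Fin 3) → ℤ),
        47 / 50 ≤ a' ∧ a' ≤ 1 ∧ (P' = fccTwoShellPattern ∨ P' = hcpTwoShellPattern) ∧
        (∀ w ∈ P', f' w ≠ f v ∧ dist (x (f' w)) (x (f v) + a' • A' w) ≤ 1 / 20 * a') ∧ Set.InjOn f' ↑P' ∧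
        (∀ k : Fin N, k ≠ f v → dist (x k) (x (f v)) ≤ 3 / 2 * a' → ∃ w ∈ P', f' w = k) ∧
        Set.InjOn (fun w => barlowPos 1 (Real.sqrt 6 / 3) s (σm w) (σu w) (σw w)) ↑P' ∧
        (∀ w ∈ P', R (barlowPos 1 (Real.sqrt 6 / 3) s (σm w) (σu w) (σw w)) ≠ v ∧
          dist (R (barlowPos 1 (Real.sqrt 6 / 3) s (σm w) (σu w) (σw w))) v ≤ 3 / 2 ∧
          ((‖barlowPos 1 (Real.sqrt 6 / 3) s (σm w) (σu w) (σw w)‖ ≤ 43 / 20 ∨ dist (x (f' w)) (x i) ≤ 2) →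
            dist (x (f' w)) (x i + a • A (R (barlowPos 1 (Real.sqrt 6 / 3) s (σm w) (σu w) (σw w)))) ≤ 2 / 5))) := by
  classical
  set cen := modelList cenHcp with hcen_def
  have hcen : cen.Nodup := nodup_modelList cenHcp
  have h0 : ((0 : ℤ), (0 : ℤ), (0 : ℤ)) ∉ cen := by rw [hcen_def]; cases cenHcp <;> decide
  have ha0 : 0 < a := by linarith
  -- ### normalised coordinates
  set Ae := A.toLinearIsometryEquiv rfl with hAe
  have hAeA : ∀ y, A (Ae.symm y) = y := fun y => by
    rw [show A (Ae.symm y) = Ae (Ae.symm y) by rw [hAe, LinearIsometry.coe_toLinearIsometryEquiv],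
      LinearIsometryEquiv.apply_symm_apply]
  set pos : Fin N → EuclideanSpace ℝ (Fin 3) := fun k => Ae.symm (a⁻¹ • (x k - x i)) with hpos
  have hx : ∀ k, x k = x i + a • A (pos k) := fun k => by
    simp only [hpos, hAeA, smul_smul, mul_inv_cancel₀ ha0.ne', one_smul]; abel
  have hdist : ∀ k (q : EuclideanSpace ℝ (Fin 3)), dist (x k) (x i + a • A q) = a * ‖pos k - q‖ := fun k q => by
    conv_lhs => rw [hx k]
    rw [dist_eq_norm, add_sub_add_left_eq_sub, ← smul_sub, ← map_sub, norm_smul, A.norm_map,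
      Real.norm_of_nonneg ha0.le]
  have hdist0 : ∀ k, dist (x k) (x i) = a * ‖pos k‖ := fun k => by
    have := hdist k 0; rwa [map_zero, smul_zero, add_zero, sub_zero] at this
  have hpos0 : pos i = 0 := by simp [hpos]
  -- ### the centre
  set fC : IVec → Fin N := fun c => f (pt c) with hfC
  have hC : CentreGood cen pos i fC := by
    refine ⟨hpos0, fun c hc => ?_, fun c hc c' hc' h => ?_, fun k hk hd => ?_⟩
    · have hm := pt_mem_pattern hc
      refine ⟨(hf _ hm).1, ?_⟩
      have := (hf _ hm).2
      rw [hdist] at this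
      nlinarith
    · exact pt_injective (hinj (pt_mem_pattern hc) (pt_mem_pattern hc') h)
    · have : dist (x k) (x i) ≤ 3 / 2 * a := by rw [hdist0]; nlinarith
      obtain ⟨v, hv, hfv⟩ := hcomp k hk this
      obtain ⟨c, hc, rfl⟩ := exists_pt_eq_of_mem_pattern hv
      exact ⟨c, hc, hfv⟩
  -- ### the pivots: original witnesses
  have horbits := orbits_of_checkAllOrbits horb
  haveI : Nonempty (Fin N) := ⟨i⟩
  haveI : Nonempty (PivotW (Fin N)) := ⟨⟨false, 0, 0, fun _ => i⟩⟩
  have hpack : ∀ v ∈ cen, ∃ (W : PivotW (Fin N)) (a' : ℝ)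
      (A'' : EuclideanSpace ℝ (Fin 3) →ₗᵢ[ℝ] EuclideanSpace ℝ (Fin 3)) (f'' : EuclideanSpace ℝ (Fin 3) → Fin N),
      PivotGood pos (fC v) W ∧
      (∀ cs reps, repsOf data v = some (cs, reps) → ∃ phi, (W.t, phi) ∈ reps ∧ LabelsOK i fC W cs phi) ∧
      47 / 50 ≤ a' ∧ a' ≤ 1 ∧
      (∀ w' ∈ patternOf W.t, f'' w' ≠ fC v ∧ dist (x (f'' w')) (x (fC v) + a' • A'' w') ≤ 1 / 20 * a') ∧
      Set.InjOn f'' ↑(patternOf W.t) ∧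
      (∀ k, k ≠ fC v → dist (x k) (x (fC v)) ≤ 3 / 2 * a' → ∃ w' ∈ patternOf W.t, f'' w' = k) ∧
      (∀ w ∈ modelList W.t, W.fP w = f'' (pt w)) := by
    intro v hv
    -- the pivot particle is good
    have hj3 : dist (x (fC v)) (x i) ≤ 3 := by
      have h1 := (hf _ (pt_mem_pattern hv)).2
      have h2 : ‖pt v‖ ≤ Real.sqrt 2 := norm_le_sqrt_two_of_mem_twoShellPattern (patternOf_eq_or cenHcp) (pt_mem_pattern hv)
      rw [hdist] at h1
      rw [hdist0]
      have hs2 : Real.sqrt 2 ≤ 3 / 2 := by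
        rw [show (3 / 2 : ℝ) = Real.sqrt ((3 / 2) ^ 2) by rw [Real.sqrt_sq]; norm_num]
        exact Real.sqrt_le_sqrt (by norm_num)
      have : ‖pos (fC v)‖ ≤ ‖pos (fC v) - pt v‖ + ‖pt v‖ := norm_le_norm_sub_add _ _
      nlinarith
    obtain ⟨a', ha1', ha2', A', P', f', hP', hf', hinj', hcomp'⟩ := hgood _ hj3
    -- its type
    obtain ⟨t, rfl⟩ : ∃ t : Bool, P' = patternOf t := by
      rcases hP' with rfl | rfl
      · exact ⟨false, rfl⟩
      · exact ⟨true, rfl⟩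
    have ha0' : 0 < a' := by linarith
    set ρ := a' / a with hρ
    have hρ1 : 47 / 50 ≤ ρ := by rw [hρ, le_div_iff₀ ha0]; nlinarith
    have hρ2 : ρ ≤ 50 / 47 := by rw [hρ, div_le_iff₀ ha0]; nlinarith
    have hρ0 : 0 < ρ := by positivity
    set B : EuclideanSpace ℝ (Fin 3) →ₗ[ℝ] EuclideanSpace ℝ (Fin 3) :=
      ρ • (Ae.symm.toLinearIsometry.toLinearMap ∘ₗ A'.toLinearMap) with hB
    have hBapply : ∀ z, B z = ρ • Ae.symm (A' z) := fun z => rfl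
    have hframe : ∀ z, x (fC v) + a' • A' z = x i + a • A (pos (fC v) + B z) := fun z => by
      have e1 : A (B z) = ρ • A' z := by rw [hBapply, map_smul, hAeA]
      rw [map_add, smul_add, e1, smul_smul, show a * ρ = a' by rw [hρ]; field_simp, hx (fC v)]
      abel
    set W₀ : PivotW (Fin N) := ⟨t, B, ρ, fun w => f' (pt w)⟩ with hW₀
    have hW₀ : PivotGood pos (fC v) W₀ := by
      refine ⟨fun z => ?_, hρ1, hρ2, fun w hw => ?_, fun w hw w' hw' h => ?_, fun k hk hd => ?_⟩
      · show ‖B z‖ = ρ * ‖z‖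
        rw [hBapply, norm_smul, Real.norm_of_nonneg hρ0.le, LinearIsometryEquiv.norm_map, A'.norm_map]
      · have hm := pt_mem_pattern hw
        refine ⟨(hf' _ hm).1, ?_⟩
        have := (hf' _ hm).2
        rw [hframe, hdist] at this
        show ‖pos (f' (pt w)) - (pos (fC v) + B (pt w))‖ ≤ ρ / 20
        rw [hρ, div_div, le_div_iff₀ (by positivity)]
        nlinarith
      · exact pt_injective (hinj' (pt_mem_pattern hw) (pt_mem_pattern hw') h)
      · have hd' : dist (x k) (x (fC v)) ≤ 3 / 2 * a' := by
          have : ‖pos k - pos (fC v)‖ ≤ 3 / 2 * ρ := hd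
          calc dist (x k) (x (fC v)) = a * ‖pos k - pos (fC v)‖ := by rw [hx (fC v), hdist]
            _ ≤ a * (3 / 2 * ρ) := by gcongr
            _ = 3 / 2 * a' := by rw [hρ]; field_simp
        obtain ⟨w', hw', hfw⟩ := hcomp' k hk hd'
        obtain ⟨z, hz, rfl⟩ := exists_pt_eq_of_mem_pattern hw'
        exact ⟨z, hz, hfw⟩
    -- representatives and the symmetrised witness
    obtain ⟨cs, reps, assign, hro, hco⟩ := horbits v hv
    obtain ⟨g, hg, phi₀, hrep, hWg, hLg⟩ := exists_rep_witness hC hcen h0 hv hW₀ hco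
    obtain ⟨s1, s2, s3⟩ := signs_of_mem_symList t g hg
    set G : EuclideanSpace ℝ (Fin 3) →ₗᵢ[ℝ] EuclideanSpace ℝ (Fin 3) := ⟨symLin g, norm_symLin s1 s2 s3⟩ with hG
    have hGapply : ∀ y, G y = symLin g y := fun y => rfl
    have hperm := perm_map_symApply hg
    have hGmem : ∀ w' ∈ patternOf t, G w' ∈ patternOf t := by
      intro w' hw'
      obtain ⟨z, hz, rfl⟩ := exists_pt_eq_of_mem_pattern hw'
      rw [hGapply, symLin_pt]
      exact pt_mem_pattern (hperm.mem_iff.1 (List.mem_map_of_mem hz))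
    refine ⟨⟨t, B ∘ₗ symLin g, ρ, fun w => f' (pt (symApply g w))⟩, a', A'.comp G, fun w' => f' (G w'),
      hWg, fun cs' reps' hro' => ?_, ha1', ha2', fun w' hw' => ?_, fun w₁ hw₁ w₂ hw₂ h => ?_,
      fun k hk hd => ?_, fun w hw => ?_⟩
    · rw [hro] at hro'
      simp only [Option.some.injEq, Prod.mk.injEq] at hro'
      obtain ⟨rfl, rfl⟩ := hro'
      exact ⟨phi₀, hrep, hLg⟩
    · have := hf' _ (hGmem w' hw')
      simpa only [LinearIsometry.coe_comp, Function.comp_apply] using this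
    · exact G.injective (hinj' (hGmem w₁ hw₁) (hGmem w₂ hw₂) h)
    · obtain ⟨w', hw', hfw⟩ := hcomp' k hk hd
      obtain ⟨z, hz, rfl⟩ := exists_pt_eq_of_mem_pattern hw'
      obtain ⟨z₀, hz₀, rfl⟩ := List.mem_map.1 (hperm.mem_iff.2 hz)
      exact ⟨pt z₀, pt_mem_pattern hz₀, by show f' (G (pt z₀)) = k; rw [hGapply, symLin_pt]; exact hfw⟩
    · show f' (pt (symApply g w)) = f' (G (pt w))
      rw [hGapply, symLin_pt]
  -- ### choose the witnesses and run the tree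
  choose! W af Af ff hW hrep ha1f ha2f hff hinjf hcompf hlink using hpack
  have hleaf : LeafGoal cen pos W :=
    checkTree_sound W data hC hcen h0 hW hrep 40 [] cert htree (fun a ha => by simp at ha) (by simp)
  obtain ⟨κ, assigned, wits, witI, hvalid, hbr, hwlen, hall, hA, hcover⟩ := hleaf
  -- ### read the leaf in the original coordinates
  refine ⟨ctxFrame κ, ctxWord κ, isHaggSeq_ctxWord hvalid, fun v hv => ?_, fun m u w hle hne => ?_, fun v hv => ?_⟩
  · obtain ⟨c, hc, rfl⟩ := exists_pt_eq_of_mem_pattern hv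
    exact bridge_i hbr c hc
  · obtain ⟨c, hc, h⟩ := bridge_ii hvalid hbr hle hne
    rw [h]; exact pt_mem_pattern hc
  · obtain ⟨vh, hvh, rfl⟩ := exists_pt_eq_of_mem_pattern hv
    obtain ⟨ag, hag, hag1⟩ := hcover vh hvh
    obtain ⟨hag2, hagt, hagT⟩ := hA ag hag
    obtain ⟨k, hk, rfl⟩ := List.mem_iff_getElem.1 hag
    have hk' : k < wits.length := by omega
    have hlt := all_zip_getElem hall k hk hk'
    simp only at hlt
    rw [hag1] at hlt hagT
    obtain ⟨σ, hσinj, hσ⟩ := leafGoal_placement (W := W vh) hagT hlt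
    -- the label of a pattern point
    set lab : EuclideanSpace ℝ (Fin 3) → IVec := fun w' => Classical.epsilon fun z => z ∈ modelList (W vh).t ∧ pt z = w'
      with hlab
    have hlabspec : ∀ w' ∈ patternOf (W vh).t, lab w' ∈ modelList (W vh).t ∧ pt (lab w') = w' := fun w' hw' =>
      Classical.epsilon_spec (p := fun z => z ∈ modelList (W vh).t ∧ pt z = w') (exists_pt_eq_of_mem_pattern hw')
    have hfv : f (pt vh) = fC vh := rfl
    refine ⟨af vh, Af vh, patternOf (W vh).t, ff vh, fun w' => (σ (lab w')).1, fun w' => (σ (lab w')).2.1,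
      fun w' => (σ (lab w')).2.2, ha1f vh hvh, ha2f vh hvh, patternOf_eq_or _, ?_, hinjf vh hvh, ?_, ?_, ?_⟩
    · rw [hfv]; exact hff vh hvh
    · rw [hfv]; exact hcompf vh hvh
    · intro w₁ hw₁ w₂ hw₂ h
      obtain ⟨hl1, hp1⟩ := hlabspec w₁ hw₁
      obtain ⟨hl2, hp2⟩ := hlabspec w₂ hw₂
      have := hσinj hl1 hl2 h
      rw [← hp1, ← hp2, this]
    · intro w' hw'
      obtain ⟨hl, hp⟩ := hlabspec w' hw'
      obtain ⟨hne, hdle, hmet⟩ := hσ (lab w') hl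
      refine ⟨hne, hdle, fun hcond => ?_⟩
      have hlink' : (W vh).fP (lab w') = ff vh w' := by rw [hlink vh hvh _ hl, hp]
      rw [hdist]
      have hm := hmet ?_
      · rw [hlink'] at hm
        nlinarith
      · rcases hcond with hc | hc
        · exact Or.inl hc
        · right
          rw [hdist0, ← hlink'] at hc
          rw [le_div_iff₀ (by norm_num : (0 : ℝ) < 47)]
          nlinarith

/-! ### The registered stub -/

/-- **Stub `stub_labelledPlacement`** of crux stmt-AtomisticToContinuum-16827 (line `birth`; verbatim the hypothesis of
`stub_chartCore_of_labelled_placement`, through which it proves the twin-shared `stub_chartCore` of stmt-13958). -/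
theorem stub_labelledPlacement :
    ∀ (N : ℕ) (x : Fin N → EuclideanSpace ℝ (Fin 3)) (i : Fin N),
      (∀ k : Fin N, dist (x k) (x i) ≤ 3 → IsTwoShellGood (1 / 20) (47 / 50) 1 x k) →
      ∀ (a : ℝ) (A : EuclideanSpace ℝ (Fin 3) →ₗᵢ[ℝ] EuclideanSpace ℝ (Fin 3)) (P : Finset (EuclideanSpace ℝ (Fin 3)))
        (f : EuclideanSpace ℝ (Fin 3) → Fin N),
        47 / 50 ≤ a → a ≤ 1 → (P = fccTwoShellPattern ∨ P = hcpTwoShellPattern) →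
        (∀ v ∈ P, f v ≠ i ∧ dist (x (f v)) (x i + a • A v) ≤ 1 / 20 * a) → Set.InjOn f ↑P →
        (∀ j : Fin N, j ≠ i → dist (x j) (x i) ≤ 3 / 2 * a → ∃ v ∈ P, f v = j) →
        ∃ (R : EuclideanSpace ℝ (Fin 3) →ₗᵢ[ℝ] EuclideanSpace ℝ (Fin 3)) (s : ℤ → ℤ), IsHaggSeq s ∧
          (∀ v ∈ P, ∃ m u w : ℤ, R (barlowPos 1 (Real.sqrt 6 / 3) s m u w) = v) ∧
          (∀ m u w : ℤ, ‖barlowPos 1 (Real.sqrt 6 / 3) s m u w‖ ≤ 3 / 2 → barlowPos 1 (Real.sqrt 6 / 3) s m u w ≠ 0 →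
            R (barlowPos 1 (Real.sqrt 6 / 3) s m u w) ∈ P) ∧
          (∀ v ∈ P, ∃ (a' : ℝ) (A' : EuclideanSpace ℝ (Fin 3) →ₗᵢ[ℝ] EuclideanSpace ℝ (Fin 3))
            (P' : Finset (EuclideanSpace ℝ (Fin 3))) (f' : EuclideanSpace ℝ (Fin 3) → Fin N)
            (σm σu σw : EuclideanSpace ℝ (Fin 3) → ℤ),
            47 / 50 ≤ a' ∧ a' ≤ 1 ∧ (P' = fccTwoShellPattern ∨ P' = hcpTwoShellPattern) ∧
            (∀ w ∈ P', f' w ≠ f v ∧ dist (x (f' w)) (x (f v) + a' • A' w) ≤ 1 / 20 * a') ∧ Set.InjOn f' ↑P' ∧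
            (∀ k : Fin N, k ≠ f v → dist (x k) (x (f v)) ≤ 3 / 2 * a' → ∃ w ∈ P', f' w = k) ∧
            Set.InjOn (fun w => barlowPos 1 (Real.sqrt 6 / 3) s (σm w) (σu w) (σw w)) ↑P' ∧
            (∀ w ∈ P', R (barlowPos 1 (Real.sqrt 6 / 3) s (σm w) (σu w) (σw w)) ≠ v ∧
              dist (R (barlowPos 1 (Real.sqrt 6 / 3) s (σm w) (σu w) (σw w))) v ≤ 3 / 2 ∧
              ((‖barlowPos 1 (Real.sqrt 6 / 3) s (σm w) (σu w) (σw w)‖ ≤ 43 / 20 ∨ dist (x (f' w)) (x i) ≤ 2) →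
                dist (x (f' w)) (x i + a • A (R (barlowPos 1 (Real.sqrt 6 / 3) s (σm w) (σu w) (σw w)))) ≤ 2 / 5))) := by
  intro N x i hgood a A P f ha1 ha2 hP hf hinj hcomp
  rcases hP with rfl | rfl
  · exact labelledPlacement_of_cert false dataFcc assignsFcc certFcc checkAllOrbits_fcc checkTree_fcc N x i hgood a A f
      ha1 ha2 hf hinj hcomp
  · exact labelledPlacement_of_cert true dataHcp assignsHcp certHcp checkAllOrbits_hcp checkTree_hcp N x i hgood a A f
      ha1 ha2 hf hinj hcomp

end Summit.AtomisticToContinuum.Crystallization.Theorems.NashClassCertificatesNashNearField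

end
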